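import Literature.ModelTheory.Quasiminimal.PregeometryClasses
import Literature.ModelTheory.Quasiminimal.CountableModels
import HarnessLib

/-!
# Closed embeddings between members of a quasiminimal pregeometry class (Kirby 2010, Thm 2.1)

L. Haykazyan, *Categoricity in quasiminimal pregeometry classes*, J. Symbolic Logic 81 (2016),
Def. 2 (`IsQuasiminimalPregeometryClass`, `PregeometryClasses.lean`) and Props 4–5; J. Kirby,
*On quasiminimal excellent classes*, J. Symbolic Logic 75 (2010), Lemma 1.3, Thm 2.1, Lemma 3.1.
This file supplies the elementary tools of the uniqueness proof for members `H, H'` of a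
quasiminimal pregeometry class, all ACROSS two structures:

* `IsQuasiminimalPregeometryClass.isWeaklyQuasiminimalPregeometryStructure` — every member is
  a weakly quasiminimal pregeometry structure in the sense of BHHKK 2014 / Bays–Kirby 2018
  (`PregeometryStructures.lean`), so that the one-structure theory of the tree (Kirby's Thm 2.1
  and Prop. 2.3 inside a countable model, BHHKK's splitting, isolation and excellence) applies to
  each member;
* `IsPartialEmbOn.image_cl_eq_of_closed` — closed partial embeddings carry closures of subsets
  onto closures of their images (Kirby 2010, Lemma 1.3; Haykazyan Prop. 4);
* `IsPregeometry.cl_inter_cl_eq_of_clIndep` — Kirby 2010, Lemma 3.1: for subsets `X, Y` of an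
  independent set, `cl X ∩ cl Y = cl (X ∩ Y)`;
* `isPartialEmbOn_union_of_append` — a map is a partial embedding on `S ∪ T` as soon as it
  preserves the quantifier-free types of the concatenations of a tuple from `S` and a tuple from
  `T`;
* `IsPartialEmbOn.toEquiv` — a bijective partial embedding on `univ` is an isomorphism of
  `L`-structures;
* `IsQuasiminimalPregeometryClass.exists_isPartialEmbOn_extend_indepFamily` — **Kirby 2010,
  Thm 2.1 across two members, countable case**: a partial embedding `f` on a countable closed `G`
  (with closed image, or `G = ∅`) together with a matching `u i ↦ u' i` of countable families
  independent over `G`, resp. over `f[G]`, extends to a partial embedding of `cl (G ∪ range u)`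
  onto `cl (f[G] ∪ range u')`. The proof is the tree's one-structure proof
  (`CountableModels.lean`, `exists_isQFEmbOn_extend_indepFamily`) verbatim with the two
  structures kept apart: enumerate the family, at successor stages match the new independent
  point by uniqueness of the generic type and extend through the countable closure by
  `ℵ₀`-homogeneity (`exists_isPartialEmbOn_cl_extend`), and take the union.

Everything is proved; no named facts are introduced.

## References

* J. Kirby, *On quasiminimal excellent classes*, J. Symbolic Logic 75 (2010) 551–564: Lemma 1.3,
  Thm 2.1, Lemma 3.1.
* L. Haykazyan, *Categoricity in quasiminimal pregeometry classes*, J. Symbolic Logic 81 (2016)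
  56–64: Def. 2, Props 4–5.
* M. Bays, B. Hart, T. Hyttinen, M. Kesälä, J. Kirby, *Quasiminimal structures and excellence*,
  Bull. LMS 46 (2014): Def. 2.1.
-/

noncomputable section

open Set
open FirstOrder FirstOrder.Language

universe u v w

namespace Literature.ModelTheory.Quasiminimal

/-! ### Kirby's Lemma 3.1 -/

/-- **Kirby 2010, Lemma 3.1**: for subsets `X, Y` of an independent set of a pregeometry,
`cl X ∩ cl Y = cl (X ∩ Y)` (via the matroid of the pregeometry and
`Matroid.Indep.closure_inter_eq_inter_closure`). [cite: Kirby2010QMEC, Lemma 3.1] -/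
theorem IsPregeometry.cl_inter_cl_eq_of_clIndep {M : Type*} {cl : Set M → Set M}
    (h : IsPregeometry cl) {B : Set M} (hB : ClIndep cl B) {X Y : Set M} (hX : X ⊆ B) (hY : Y ⊆ B) :
    cl X ∩ cl Y = cl (X ∩ Y) := by
  have hXY : h.matroid.Indep (X ∪ Y) :=
    (h.matroid_indep_iff).2 (hB.subset h.mono (union_subset hX hY))
  have := hXY.closure_inter_eq_inter_closure
  rw [h.matroid_closure, h.matroid_closure, h.matroid_closure] at this
  exact this.symm

/-- Injective families inside an independent set are independent families (over `∅`). [folklore] -/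
theorem ClIndep.indepFamilyOver_empty {M : Type*} {cl : Set M → Set M} (h : IsPregeometry cl)
    {B : Set M} (hB : ClIndep cl B) {ι : Type*} {u : ι → M} (hu : Function.Injective u)
    (huB : ∀ i, u i ∈ B) : IndepFamilyOver cl ∅ u := by
  intro i hi
  rw [empty_union] at hi
  refine hB (huB i) (h.mono ?_ hi)
  rintro _ ⟨j, hj, rfl⟩
  exact ⟨huB j, fun hji => hj (hu hji)⟩

/-- An element of an independent set is not in the closure of a part of the set avoiding it.
[folklore] -/
theorem ClIndep.notMem_cl_of_subset {M : Type*} {cl : Set M → Set M} (h : IsPregeometry cl)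
    {B : Set M} (hB : ClIndep cl B) {x : M} (hx : x ∈ B) {S : Set M} (hS : S ⊆ B) (hxS : x ∉ S) :
    x ∉ cl S := fun hxcl =>
  hB hx (h.mono (show S ⊆ B \ {x} from
    fun _ hy => ⟨hS hy, fun hyx => hxS (mem_singleton_iff.1 hyx ▸ hy)⟩) hxcl)

/-- Injective families inside an independent set `B`, avoiding a part `B₀ ⊆ B`, are independent
over `cl B₀`. [folklore] -/
theorem ClIndep.indepFamilyOver_cl {M : Type*} {cl : Set M → Set M} (h : IsPregeometry cl)
    {B : Set M} (hB : ClIndep cl B) {B₀ : Set M} (hB₀ : B₀ ⊆ B) {ι : Type*} {u : ι → M}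
    (hu : Function.Injective u) (huB : ∀ i, u i ∈ B) (huB₀ : ∀ i, u i ∉ B₀) :
    IndepFamilyOver cl (cl B₀) u := by
  intro i hi
  rw [h.cl_cl_union] at hi
  refine hB.notMem_cl_of_subset h (huB i) (S := B₀ ∪ u '' {j | j ≠ i}) ?_ ?_ hi
  · rintro y (hy | ⟨j, -, rfl⟩)
    · exact hB₀ hy
    · exact huB j
  · rintro (hy | ⟨j, hj, hji⟩)
    · exact huB₀ i hy
    · exact hj (hu hji)

/-! ### Partial embeddings on unions, and isomorphisms from bijective partial embeddings -/

section PartialEmb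

variable {L : Language.{v, w}} {M : Type*} {N : Type*} [L.Structure M] [L.Structure N]

/-- **A map is a partial embedding on `S ∪ T` if it preserves the quantifier-free types of all
concatenations of a tuple from `S` with a tuple from `T`** (a finite tuple from `S ∪ T` is a
re-indexing of such a concatenation). [folklore] -/
theorem isPartialEmbOn_union_of_append {f : M → N} {S T : Set M}
    (h : ∀ ⦃m n : ℕ⦄ (a : Fin m → M) (c : Fin n → M), (∀ i, a i ∈ S) → (∀ j, c j ∈ T) →
      L.EqQFType₂ (Fin.append a c) (Fin.append (f ∘ a) (f ∘ c))) :
    IsPartialEmbOn L f (S ∪ T) := by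
  classical
  intro N₀ x hx
  -- coordinates in `S`, and the others (in `T`)
  let s : Finset (Fin N₀) := Finset.univ.filter fun i => x i ∈ S
  let t : Finset (Fin N₀) := Finset.univ.filter fun i => x i ∉ S
  let es : Fin s.card ≃ s := (Finset.equivFin s).symm
  let et : Fin t.card ≃ t := (Finset.equivFin t).symm
  let a : Fin s.card → M := fun j => x (es j)
  let c : Fin t.card → M := fun j => x (et j)
  have ha : ∀ j, a j ∈ S := fun j => (Finset.mem_filter.1 (es j).2).2
  have hc : ∀ j, c j ∈ T := fun j => by
    have h1 : x (et j) ∉ S := (Finset.mem_filter.1 (et j).2).2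
    exact (hx _).resolve_left h1
  let ι : Fin N₀ → Fin (s.card + t.card) := fun i =>
    if hi : x i ∈ S then Fin.castAdd t.card (es.symm ⟨i, Finset.mem_filter.2 ⟨Finset.mem_univ _, hi⟩⟩)
    else Fin.natAdd s.card (et.symm ⟨i, Finset.mem_filter.2 ⟨Finset.mem_univ _, hi⟩⟩)
  have key := h a c ha hc
  have h1 : Fin.append a c ∘ ι = x := by
    funext i
    by_cases hi : x i ∈ S
    · simp only [Function.comp_apply, ι, dif_pos hi, Fin.append_left, a, Equiv.apply_symm_apply]
    · simp only [Function.comp_apply, ι, dif_neg hi, Fin.append_right, c, Equiv.apply_symm_apply]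
  have h2 : Fin.append (f ∘ a) (f ∘ c) ∘ ι = f ∘ x := by
    funext i
    by_cases hi : x i ∈ S
    · simp only [Function.comp_apply, ι, dif_pos hi, Fin.append_left, a, Equiv.apply_symm_apply]
    · simp only [Function.comp_apply, ι, dif_neg hi, Fin.append_right, c, Equiv.apply_symm_apply]
  have := key.comp ι
  rw [h1, h2] at this
  exact this

/-- **A bijective partial embedding on `univ` is an isomorphism of `L`-structures.** Function
symbols are respected because the graph of a basic function is an atomic formula
(`IsPartialEmbOn.apply_funMap`), relation symbols because they are atomic formulas. [folklore] -/
def IsPartialEmbOn.toEquiv {f : M → N} (hf : IsPartialEmbOn L f univ) (hbij : Function.Bijective f) :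
    M ≃[L] N where
  toEquiv := Equiv.ofBijective f hbij
  map_fun' := by
    intro n φ x
    exact hf.apply_funMap φ (fun _ => mem_univ _) (mem_univ _)
  map_rel' := by
    intro n R x
    have := hf x (fun _ => mem_univ _)
    have key := this.realize_iff_of_isQF (φ := R.formula var)
      (BoundedFormula.IsQF.of_isAtomic (BoundedFormula.IsAtomic.rel R _))
    simp only [Formula.realize_rel, Term.realize_var] at key
    show Structure.RelMap R (f ∘ x) ↔ Structure.RelMap R x
    exact key.symm

/-- The isomorphism of `IsPartialEmbOn.toEquiv` is the given map. [folklore] -/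
@[simp] theorem IsPartialEmbOn.toEquiv_apply {f : M → N} (hf : IsPartialEmbOn L f univ)
    (hbij : Function.Bijective f) (x : M) : hf.toEquiv hbij x = f x := rfl

end PartialEmb

/-! ### Members of a class are weakly quasiminimal pregeometry structures -/

namespace IsQuasiminimalPregeometryClass

variable {L : Language.{v, w}}
variable {𝒞 : ∀ (H : Type u) [L.Structure H], (Set H → Set H) → Prop}
variable {H H' : Type u} [L.Structure H] [L.Structure H'] {cl : Set H → Set H} {cl' : Set H' → Set H'}

/-- **Every member of a quasiminimal pregeometry class is a weakly quasiminimal pregeometry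
structure** (BHHKK 2014, Def. 2.1: QM1, QM3, QM4, QM5), by specialising Haykazyan's axioms to
`H' = H`: the vocabulary of `PregeometryStructures.lean` is the `H = H'` case of the two-structure
vocabulary (`eqQFType₂_iff_eqQFType`, `eqQFTypeOver₂_iff_eqQFTypeOver`). Hence the one-structure
theory (Kirby's Thm 2.1 and Prop. 2.3 in a countable model, BHHKK's Props 4.2, 5.2, 6.2) applies
to members. [cite: Haykazyan2016, Definition 2] [cite: BHHKK2014, Def. 2.1] -/
theorem isWeaklyQuasiminimalPregeometryStructure (h𝒞 : IsQuasiminimalPregeometryClass L 𝒞)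
    (hH : 𝒞 H cl) : IsWeaklyQuasiminimalPregeometryStructure L H cl where
  isPregeometry := h𝒞.isPregeometry hH
  mem_cl_of_eqQFType := by
    intro n b b' a a' h ha
    exact (h𝒞.mem_cl_iff_of_eqQFType₂_snoc hH hH (eqQFType₂_iff_eqQFType.2 h)).1 ha
  countable_cl := h𝒞.countable_cl hH
  uniqueness_of_generic_type := by
    intro G f hGc hG hfG hf a a' ha ha'
    have hfemb : IsPartialEmbOn L f G :=
      isPartialEmbOn_iff_isQFEmbOn.2 (isQFEmbOn_iff_eqQFTypeOver_elim0.2 hf)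
    have := h𝒞.eqQFTypeOver₂_of_notMem_of_closed hH hH G f hGc hG hfG hfemb
      (x := a) (x' := a') (by rwa [hG]) (by rwa [hfG])
    exact eqQFTypeOver₂_iff_eqQFTypeOver.1 this
  homogeneity_over_closed := by
    intro G f hGc hG n x x' hxx' a ha
    obtain ⟨a', ha'⟩ := h𝒞.exists_eqQFTypeOver₂_snoc hH hH G f hGc hG x x'
      (eqQFTypeOver₂_iff_eqQFTypeOver.2 hxx') ha
    exact ⟨a', eqQFTypeOver₂_iff_eqQFTypeOver.1 ha'⟩

/-! ### Closed partial embeddings carry closures to closures -/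

/-- **Transport of closure membership along a partial embedding** (axiom (3iii) with all sets
inside the domain): for `S ⊆ D`, `y ∈ D` and `f` a partial embedding on `D`,
`y ∈ cl S ↔ f y ∈ cl' (f[S])`. [cite: Haykazyan2016, Definition 2] -/
theorem mem_cl_iff_mem_cl_image (h𝒞 : IsQuasiminimalPregeometryClass L 𝒞) (hH : 𝒞 H cl)
    (hH' : 𝒞 H' cl') {f : H → H'} {D : Set H} (hf : IsPartialEmbOn L f D) {S : Set H} (hS : S ⊆ D)
    {y : H} (hy : y ∈ D) : y ∈ cl S ↔ f y ∈ cl' (f '' S) :=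
  h𝒞.mem_cl_iff_of_isPartialEmbOn hH hH' S y f (hf.mono (insert_subset hy hS))

/-- **Closed partial embeddings map closures onto closures** (Kirby 2010, Lemma 1.3; Haykazyan
2016, Prop. 4): if `f` is a partial embedding on the closed set `D` with closed image then
`f '' cl S = cl' (f '' S)` for every `S ⊆ D`. [cite: Kirby2010QMEC, Lemma 1.3] -/
theorem image_cl_eq_of_closed (h𝒞 : IsQuasiminimalPregeometryClass L 𝒞) (hH : 𝒞 H cl)
    (hH' : 𝒞 H' cl') {f : H → H'} {D : Set H} (hf : IsPartialEmbOn L f D) (hD : cl D = D)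
    (hfD : cl' (f '' D) = f '' D) {S : Set H} (hS : S ⊆ D) : f '' cl S = cl' (f '' S) := by
  have hP := h𝒞.isPregeometry hH
  have hP' := h𝒞.isPregeometry hH'
  have hclS : cl S ⊆ D := hP.cl_subset_of_subset hS hD
  apply Subset.antisymm
  · rintro _ ⟨y, hy, rfl⟩
    exact (h𝒞.mem_cl_iff_mem_cl_image hH hH' hf hS (hclS hy)).1 hy
  · intro y' hy'
    have : y' ∈ f '' D := by
      rw [← hfD]
      exact hP'.mono (image_mono hS) hy'
    obtain ⟨y, hyD, rfl⟩ := this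
    exact ⟨y, (h𝒞.mem_cl_iff_mem_cl_image hH hH' hf hS hyD).2 hy', rfl⟩

/-- A partial embedding on a closed set with closed image, in the `EqQFTypeOver₂` form needed by
the successor step: `(cl D = D ∧ cl' (f '' D) = f '' D) ∨ D = ∅`. Helper to produce the image
closedness from an image formula. [folklore] -/
theorem closed_pair_of_image_eq (h𝒞 : IsQuasiminimalPregeometryClass L 𝒞) (hH : 𝒞 H cl)
    (hH' : 𝒞 H' cl') {f : H → H'} {D : Set H} {D' : Set H'} (hD : cl D = D) (hD' : cl' D' = D')
    (himg : f '' D = D') : (cl D = D ∧ cl' (f '' D) = f '' D) ∨ D = ∅ := by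
  have _ := h𝒞.isPregeometry hH
  have _ := h𝒞.isPregeometry hH'
  exact Or.inl ⟨hD, by rw [himg]; exact hD'⟩

/-! ### Kirby's Theorem 2.1 across two members (countable case) -/

/-- **Kirby 2010, Theorem 2.1, across two members of the class (countable index).** Let
`⟨H, cl⟩, ⟨H', cl'⟩ ∈ 𝒞`, `G ⊆ H` countable and closed with `f` a partial embedding on `G` whose
image is closed (or `G = ∅` and `f` arbitrary), and let `u : ι → H`, `u' : ι → H'` (`ι` countable)
be independent over `G`, resp. over `f[G]`. Then `f ∪ (u i ↦ u' i)` extends to a partial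
embedding `F` of `H` into `H'` on `cl (G ∪ range u)` whose image is exactly
`cl' (f[G] ∪ range u')` — a closed embedding, an isomorphism onto its image ("in particular, if
`im ψ` spans `H'` then `ψ̂` is an isomorphism"). Proof as in the source and as in the tree's
one-structure version (`exists_isQFEmbOn_extend_indepFamily`): enumerate `ι`, at a successor
stage the new point is generic on both sides (`eqQFTypeOver₂_snoc_of_notMem_cl`, axiom II.1) and
the matching extends through the countable closure (`exists_isPartialEmbOn_cl_extend`,
axiom II.2); the stages are coherent and their union is the required map.
[cite: Kirby2010QMEC, Thm 2.1] [cite: Haykazyan2016, Proposition 5] -/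
theorem exists_isPartialEmbOn_extend_indepFamily (h𝒞 : IsQuasiminimalPregeometryClass L 𝒞)
    (hH : 𝒞 H cl) (hH' : 𝒞 H' cl') {G : Set H} {f : H → H'} (hGc : G.Countable)
    (hG : (cl G = G ∧ cl' (f '' G) = f '' G) ∨ G = ∅) (hf : IsPartialEmbOn L f G)
    {ι : Type*} [Countable ι] {u : ι → H} {u' : ι → H'} (hu : IndepFamilyOver cl G u)
    (hu' : IndepFamilyOver cl' (f '' G) u') :
    ∃ F : H → H', IsPartialEmbOn L F (cl (G ∪ range u)) ∧ EqOn F f G ∧ (∀ i, F (u i) = u' i) ∧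
      F '' cl (G ∪ range u) = cl' (f '' G ∪ range u') := by
  classical
  have hP := h𝒞.isPregeometry hH
  have hP' := h𝒞.isPregeometry hH'
  have hccp := h𝒞.countable_cl hH
  -- enumerate the index type
  obtain ⟨enc, henc⟩ := exists_injective_nat ι
  let B : ℕ → Set H := fun n => u '' {i | enc i < n}
  let B' : ℕ → Set H' := fun n => u' '' {i | enc i < n}
  let Gn : ℕ → Set H := fun n => cl (G ∪ B n)
  have hBmono : Monotone B := fun n m hnm => image_mono fun i (hi : enc i < n) => lt_of_lt_of_le hi hnm
  have hB'mono : Monotone B' := fun n m hnm => image_mono fun i (hi : enc i < n) => lt_of_lt_of_le hi hnm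
  have hGmono : Monotone Gn := fun n m hnm => hP.mono (union_subset_union_right _ (hBmono hnm))
  have hB0 : B 0 = ∅ := by
    simp only [B, Nat.not_lt_zero, setOf_false, image_empty]
  have hB'0 : B' 0 = ∅ := by
    simp only [B', Nat.not_lt_zero, setOf_false, image_empty]
  have hGncl : ∀ n, cl (Gn n) = Gn n := fun n => hP.cl_cl _
  have hBc : ∀ n, (B n).Countable := fun n => (to_countable _).image u
  have hGnc : ∀ n, (Gn n).Countable := fun n => hP.countable_cl hccp (hGc.union (hBc n))
  -- the stage invariant
  let P : ℕ → (H → H') → Prop := fun n F =>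
    IsPartialEmbOn L F (Gn n) ∧ EqOn F f G ∧ (∀ i, enc i < n → F (u i) = u' i) ∧
      F '' Gn n = cl' (f '' G ∪ B' n)
  -- stage 0
  have hP0 : ∃ F, P 0 F := by
    rcases hG with ⟨hGcl, hfGcl⟩ | hGe
    · refine ⟨f, ?_, fun a _ => rfl, fun i hi => absurd hi (Nat.not_lt_zero _), ?_⟩
      · change IsPartialEmbOn L f (cl (G ∪ B 0))
        rwa [hB0, union_empty, hGcl]
      · change f '' cl (G ∪ B 0) = cl' (f '' G ∪ B' 0)
        rw [hB0, hB'0, union_empty, union_empty, hGcl, hfGcl]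
    · subst hGe
      have h00 : L.EqQFTypeOver₂ (∅ : Set H) f (Fin.elim0 : Fin 0 → H) (Fin.elim0 : Fin 0 → H') :=
        eqQFTypeOver₂_empty_iff.2 (h𝒞.eqQFType₂_elim0 hH hH')
      obtain ⟨F, hF, -, -, hFim⟩ :=
        h𝒞.exists_isPartialEmbOn_cl_extend hH hH' countable_empty (Or.inr rfl) h00
      refine ⟨F, ?_, fun a ha => absurd ha (notMem_empty a), fun i hi => absurd hi (Nat.not_lt_zero _), ?_⟩
      · change IsPartialEmbOn L F (cl (∅ ∪ B 0))
        rw [hB0]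
        rwa [range_eq_empty] at hF
      · change F '' cl (∅ ∪ B 0) = cl' (f '' ∅ ∪ B' 0)
        rw [hB0, hB'0]
        rw [range_eq_empty, range_eq_empty, image_empty] at hFim
        rw [image_empty]
        exact hFim
  -- successor stages
  have hstep : ∀ n F, P n F → ∃ F', P (n + 1) F' ∧ EqOn F' F (Gn n) := by
    rintro n F ⟨hF, hFf, hFb, hFim⟩
    by_cases hex : ∃ i, enc i = n
    · obtain ⟨i₀, hi₀⟩ := hex
      have hBsucc : B (n + 1) = B n ∪ {u i₀} := by
        ext x
        simp only [B, mem_image, mem_setOf_eq, mem_union, mem_singleton_iff]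
        constructor
        · rintro ⟨i, hi, rfl⟩
          rcases Nat.lt_succ_iff_lt_or_eq.1 hi with hi | hi
          · exact Or.inl ⟨i, hi, rfl⟩
          · exact Or.inr (by rw [henc (hi.trans hi₀.symm)])
        · rintro (⟨i, hi, rfl⟩ | rfl)
          · exact ⟨i, Nat.lt_succ_of_lt hi, rfl⟩
          · exact ⟨i₀, by omega, rfl⟩
      have hB'succ : B' (n + 1) = B' n ∪ {u' i₀} := by
        ext x
        simp only [B', mem_image, mem_setOf_eq, mem_union, mem_singleton_iff]
        constructor
        · rintro ⟨i, hi, rfl⟩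
          rcases Nat.lt_succ_iff_lt_or_eq.1 hi with hi | hi
          · exact Or.inl ⟨i, hi, rfl⟩
          · exact Or.inr (by rw [henc (hi.trans hi₀.symm)])
        · rintro (⟨i, hi, rfl⟩ | rfl)
          · exact ⟨i, Nat.lt_succ_of_lt hi, rfl⟩
          · exact ⟨i₀, by omega, rfl⟩
      have hGhyp : (cl (Gn n) = Gn n ∧ cl' (F '' Gn n) = F '' Gn n) ∨ Gn n = ∅ :=
        Or.inl ⟨hGncl n, by rw [hFim]; exact hP'.cl_cl _⟩
      have hnot : u i₀ ∉ cl (Gn n ∪ range (Fin.elim0 : Fin 0 → H)) := by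
        rw [range_eq_empty, union_empty, hGncl n]
        intro hmem
        refine hu i₀ (hP.mono (union_subset_union_right _ ?_) hmem)
        rintro _ ⟨j, hj, rfl⟩
        exact ⟨j, fun hji => absurd hi₀ (by rw [← hji]; exact Nat.ne_of_lt hj), rfl⟩
      have hnot' : u' i₀ ∉ cl' (F '' Gn n ∪ range (Fin.elim0 : Fin 0 → H')) := by
        rw [range_eq_empty, union_empty, hFim, hP'.cl_cl]
        intro hmem
        refine hu' i₀ (hP'.mono (union_subset_union_right _ ?_) hmem)
        rintro _ ⟨j, hj, rfl⟩
        exact ⟨j, fun hji => absurd hi₀ (by rw [← hji]; exact Nat.ne_of_lt hj), rfl⟩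
      have h00 : L.EqQFTypeOver₂ (Gn n) F (Fin.elim0 : Fin 0 → H) (Fin.elim0 : Fin 0 → H') := by
        have hF0 : IsPartialEmbOn L F (Gn n ∪ range (Fin.elim0 : Fin 0 → H)) := by
          rw [range_eq_empty, union_empty]; exact hF
        have := hF0.eqQFTypeOver₂
        rwa [show F ∘ (Fin.elim0 : Fin 0 → H) = Fin.elim0 from funext fun i => i.elim0] at this
      have h1pt := h𝒞.eqQFTypeOver₂_snoc_of_notMem_cl hH hH' (hGnc n) hGhyp h00 hnot hnot'
      obtain ⟨F', hF', hF'F, hF't, hF'im⟩ :=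
        h𝒞.exists_isPartialEmbOn_cl_extend hH hH' (hGnc n) hGhyp h1pt
      have hdom : cl (Gn n ∪ range (Fin.snoc (Fin.elim0 : Fin 0 → H) (u i₀) : Fin 1 → H)) =
          Gn (n + 1) := by
        rw [IsWeaklyQuasiminimalPregeometryStructure.range_snoc_elim0]
        change cl (cl (G ∪ B n) ∪ {u i₀}) = cl (G ∪ B (n + 1))
        rw [hP.cl_cl_union, hBsucc, union_assoc]
      have him : cl' (F '' Gn n ∪ range (Fin.snoc (Fin.elim0 : Fin 0 → H') (u' i₀) : Fin 1 → H')) =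
          cl' (f '' G ∪ B' (n + 1)) := by
        rw [IsWeaklyQuasiminimalPregeometryStructure.range_snoc_elim0, hFim, hP'.cl_cl_union,
          hB'succ, union_assoc]
      rw [hdom] at hF'
      rw [hdom, him] at hF'im
      refine ⟨F', ⟨hF', ?_, ?_, hF'im⟩, hF'F⟩
      · intro a ha
        rw [hF'F (subset_union_left.trans (hP.subset_cl _) ha), hFf ha]
      · intro i hi
        rcases Nat.lt_succ_iff_lt_or_eq.1 hi with hi | hi
        · have hbi : u i ∈ Gn n := hP.subset_cl _ (Or.inr ⟨i, hi, rfl⟩)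
          rw [hF'F hbi, hFb i hi]
        · have : i = i₀ := henc (hi.trans hi₀.symm)
          subst this
          have := hF't 0
          rw [IsWeaklyQuasiminimalPregeometryStructure.snoc_elim0_zero,
            IsWeaklyQuasiminimalPregeometryStructure.snoc_elim0_zero] at this
          exact this
    · -- no new point at this stage
      have hBsucc : B (n + 1) = B n := by
        ext x
        simp only [B, mem_image, mem_setOf_eq]
        constructor
        · rintro ⟨i, hi, rfl⟩
          rcases Nat.lt_succ_iff_lt_or_eq.1 hi with hi | hi
          · exact ⟨i, hi, rfl⟩
          · exact absurd ⟨i, hi⟩ hex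
        · rintro ⟨i, hi, rfl⟩
          exact ⟨i, Nat.lt_succ_of_lt hi, rfl⟩
      have hB'succ : B' (n + 1) = B' n := by
        ext x
        simp only [B', mem_image, mem_setOf_eq]
        constructor
        · rintro ⟨i, hi, rfl⟩
          rcases Nat.lt_succ_iff_lt_or_eq.1 hi with hi | hi
          · exact ⟨i, hi, rfl⟩
          · exact absurd ⟨i, hi⟩ hex
        · rintro ⟨i, hi, rfl⟩
          exact ⟨i, Nat.lt_succ_of_lt hi, rfl⟩
      have hGsucc : Gn (n + 1) = Gn n := by
        change cl (G ∪ B (n + 1)) = cl (G ∪ B n)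
        rw [hBsucc]
      refine ⟨F, ⟨?_, hFf, ?_, ?_⟩, fun a _ => rfl⟩
      · rwa [hGsucc]
      · intro i hi
        rcases Nat.lt_succ_iff_lt_or_eq.1 hi with hi | hi
        · exact hFb i hi
        · exact absurd ⟨i, hi⟩ hex
      · rw [hGsucc, hB'succ, hFim]
  -- the sequence of stages
  choose! next hnext using hstep
  obtain ⟨F₀, hF₀⟩ := hP0
  let seq : ℕ → (H → H') := fun n => Nat.rec F₀ (fun n F => next n F) n
  have hseq_succ : ∀ n, seq (n + 1) = next n (seq n) := fun n => rfl
  have hseq : ∀ n, P n (seq n) := by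
    intro n
    induction n with
    | zero => exact hF₀
    | succ n ih => rw [hseq_succ]; exact (hnext n _ ih).1
  have hcoh : ∀ {n m}, n ≤ m → EqOn (seq m) (seq n) (Gn n) := by
    intro n m hnm
    induction hnm with
    | refl => exact fun a _ => rfl
    | step hle ih =>
      intro a ha
      rw [hseq_succ, (hnext _ _ (hseq _)).2 (hGmono hle ha), ih ha]
  -- the limit map
  let Fω : H → H' := fun x => if hx : ∃ n, x ∈ Gn n then seq (Nat.find hx) x else F₀ x
  have hFω : ∀ n, EqOn Fω (seq n) (Gn n) := by
    intro n x hx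
    have hex : ∃ n, x ∈ Gn n := ⟨n, hx⟩
    simp only [Fω, dif_pos hex]
    exact (hcoh (Nat.find_min' hex hx) (Nat.find_spec hex)).symm
  have hdom : cl (G ∪ range u) = ⋃ n, Gn n := by
    have hrange : range u = ⋃ n, B n := by
      ext x
      simp only [mem_range, mem_iUnion, B, mem_image, mem_setOf_eq]
      constructor
      · rintro ⟨i, rfl⟩
        exact ⟨enc i + 1, i, Nat.lt_succ_self _, rfl⟩
      · rintro ⟨n, i, -, rfl⟩
        exact ⟨i, rfl⟩
    rw [hrange]
    exact hP.cl_union_iUnion_eq G hBmono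
  have him : cl' (f '' G ∪ range u') = ⋃ n, cl' (f '' G ∪ B' n) := by
    have hrange : range u' = ⋃ n, B' n := by
      ext x
      simp only [mem_range, mem_iUnion, B', mem_image, mem_setOf_eq]
      constructor
      · rintro ⟨i, rfl⟩
        exact ⟨enc i + 1, i, Nat.lt_succ_self _, rfl⟩
      · rintro ⟨n, i, -, rfl⟩
        exact ⟨i, rfl⟩
    rw [hrange]
    exact hP'.cl_union_iUnion_eq _ hB'mono
  refine ⟨Fω, ?_, ?_, ?_, ?_⟩
  · rw [hdom]
    exact IsPartialEmbOn.iUnion hGmono.directed_le fun n => ((hseq n).1).congr (hFω n).symm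
  · intro a ha
    have ha0 : a ∈ Gn 0 := hP.subset_cl _ (Or.inl ha)
    rw [hFω 0 ha0, (hseq 0).2.1 ha]
  · intro i
    have hbi : u i ∈ Gn (enc i + 1) := hP.subset_cl _ (Or.inr ⟨i, Nat.lt_succ_self _, rfl⟩)
    rw [hFω _ hbi, (hseq _).2.2.1 i (Nat.lt_succ_self _)]
  · rw [hdom, him, image_iUnion]
    refine iUnion_congr fun n => ?_
    rw [← (hseq n).2.2.2]
    exact image_congr fun a ha => hFω n ha

/-- **Isomorphisms between members with matched bases, countable case** (Kirby 2010, Thm 2.1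
with `G = ∅`: "if `im ψ` spans `H'` then `ψ̂` is an isomorphism"): a bijection-like matching
`u i ↦ u' i` of countable spanning independent families of two members extends to an
`L`-isomorphism. [cite: Kirby2010QMEC, Thm 2.1, Cor. 2.2] -/
theorem exists_equiv_of_indepFamilies_countable (h𝒞 : IsQuasiminimalPregeometryClass L 𝒞)
    (hH : 𝒞 H cl) (hH' : 𝒞 H' cl') {ι : Type*} [Countable ι] {u : ι → H} {u' : ι → H'}
    (hu : IndepFamilyOver cl ∅ u) (hu' : IndepFamilyOver cl' ∅ u') (hsp : cl (range u) = univ)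
    (hsp' : cl' (range u') = univ) : ∃ e : H ≃[L] H', ∀ i, e (u i) = u' i := by
  have hP := h𝒞.isPregeometry hH
  have hP' := h𝒞.isPregeometry hH'
  -- a function `H → H'` to start from (the empty partial embedding)
  obtain ⟨f⟩ : Nonempty (H → H') := by
    rcases isEmpty_or_nonempty H' with h' | h'
    · -- then `ι` is empty and so is `H`
      haveI : IsEmpty ι := ⟨fun i => isEmptyElim (u' i)⟩
      have hcl : cl (∅ : Set H) = ∅ := h𝒞.cl_empty_eq_empty_of_isEmpty hH' hH
      have : (univ : Set H) = ∅ := by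
        rw [← hsp, range_eq_empty, hcl]
      haveI : IsEmpty H := ⟨fun x => (this ▸ mem_univ x : x ∈ (∅ : Set H))⟩
      exact ⟨isEmptyElim⟩
    · exact ⟨fun _ => Classical.arbitrary H'⟩
  have hf : IsPartialEmbOn L f (∅ : Set H) :=
    IsPartialEmbOn.of_empty_iff.2 (h𝒞.eqQFType₂_elim0 hH hH')
  have hu₁ : IndepFamilyOver cl' (f '' ∅) u' := by rwa [image_empty]
  obtain ⟨F, hF, -, hFu, hFim⟩ :=
    h𝒞.exists_isPartialEmbOn_extend_indepFamily hH hH' countable_empty (Or.inr rfl) hf hu hu₁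
  rw [empty_union, hsp] at hF hFim
  rw [image_empty, empty_union, hsp', image_univ] at hFim
  have hbij : Function.Bijective F :=
    ⟨fun a c hac => hF.injOn (mem_univ a) (mem_univ c) hac, fun c => by
      have : c ∈ range F := hFim.symm ▸ mem_univ c
      exact this⟩
  exact ⟨hF.toEquiv hbij, fun i => by rw [IsPartialEmbOn.toEquiv_apply, hFu]⟩

end IsQuasiminimalPregeometryClass

end Literature.ModelTheory.Quasiminimal

end
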